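import Literature.Computability.AlgebraicComplexity.BIPPaddingDegenerations
import Literature.Combinatorics.Enumerative.PermanentLaplaceExpansion

/-!
# `GrenetZeon.DualUnipotentThreeHalves` (stmt-ValiantsHypothesis-24318) — stub S1 of the lines «slow_planes» /
# «flag_cost»: a LINE-FLAT subspace of order `k` for `per_n` consists of matrices of permanental rank `≤ k`

The registered stub `stub_permRank_of_lineFlat : PermRankOfLineFlat` of the crux workfiles
`Cruxes/DualUnipotentThreeHalves/Lines/slow_planes.lean` (val-idea-9 g2) and `…/Lines/flag_cost.lean` (val-idea-9 g3)
(val-idea-crit-3 VERDICT #14: S1 = «folklore, size M, RECORD/PORT tier»; val-lit desk g11 RULING #254 (b)(iv): port hand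
val-port-1), PROVED, with the lines' vocabulary `lineSubst` / `LineFlat` / `PermRankLE` UNFOLDED verbatim (crux workfiles are
not importable from `Theorems/`), so that the skeletons can take `stub_permRank_of_lineFlat := permRank_of_lineFlat` by `exact`.

STATEMENT.  Let `K ≤ ℂ^{n × n}` be LINE-FLAT of order `k` for the permanent: for every base point `x` and every direction
`v ∈ K`, the one-variable polynomial `s ↦ per(x + s v)` — typed as
`aeval (c ↦ C (x c) + Σ_{t : Fin 1} C (v c)·X t) (perPoly (Fin n) ℂ) ∈ MvPolynomial (Fin 1) ℂ` — has total degree `≤ k`.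
Then every `v ∈ K` has permanental rank `≤ k`: for all injections `r, c : Fin (k+1) ↪ Fin n`, the `(k+1) × (k+1)`
subpermanent `per (v (r a, c b))_{a,b}` vanishes.

PROOF (coefficient extraction at a partial-permutation base point, as re-derived by crit-3 in VERDICT #14).  Let `P = r(Fin (k+1))`
(rows) and `Q = c(Fin (k+1))` (columns); fix a bijection `ε : Pᶜ ≃ Qᶜ` and take the base point `x` = the partial permutation
matrix of `ε` (`x(i,j) = [i ∉ P ∧ j = ε i]`).  Laplace-expand `per(x + s v)` along the rows `P`
(`Literature.Combinatorics.Enumerative.permanent_eq_sum_powersetCard_mul`): the rows in `P` carry `x = 0`, so the `P × J` minor is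
`s^{k+1} · per v[P,J]`, and the complementary minor of `x + s v` has constant term `per x[Pᶜ,Jᶜ] = [J = Q]`.  Hence the coefficient
of `s^{k+1}` in `per(x + s v)` is `per v[P,Q]`, which vanishes because the total degree is `≤ k`; finally
`Literature.Combinatorics.Enumerative.sum_equiv_prod_eq_permanent_submatrix` identifies the bijection-sum minor `per v[P,Q]` with
`Matrix.permanent (Matrix.of fun a b => v (r a, c b))`.

Honest framing.  A helper (`--supports stmt-ValiantsHypothesis-24318 --as helper`); it closes ONE registered stub of the lines by name
and nothing else: S2 (`GMSBound`, Guterman–Meshulam–Spiridonov 2023 Cor. 1.6), S3/S3b (`SlowPlane` / `FlagCostLaw`, LAW tier), the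
crux `DualUnipotentThreeHalves`, rung 8062 and `VP ≠ VNP` are all untouched / NOT proved.  No definitions, no named facts.
[folklore] (multilinearity / Laplace expansion of the permanent; Minc, *Permanents*, Ch. 2, Thm. 1.2 via the tree).
-/

-- `Summit.ValiantsHypothesis.ValiantsHypothesis.…` repeats a component by the D-0017 layout
-- (single-conjunct summit), which the `dupNamespace` linter flags; the name is mandated.
set_option linter.dupNamespace false

noncomputable section

namespace Summit.ValiantsHypothesis.ValiantsHypothesis.Theorems.GrenetZeon.SlowPlanes

open MvPolynomial Matrix Finset
open scoped BigOperators
open Literature.Computability.AlgebraicComplexity (perPoly aeval_perPoly)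
open Literature.Combinatorics.Enumerative (permanent_eq_sum_powersetCard_mul sum_equiv_prod_eq_permanent_submatrix)

/-! ## Two small bookkeeping lemmas -/

/-- A bijection-sum of products of indicator entries `[ε p = b p]` counts the bijections that agree with `ε` pointwise
on the underlying type; if the target finsets differ (but have the same size) there is none. [folklore] -/
theorem sum_equiv_prod_indicator_eq_zero {n : ℕ} {P J Q : Finset (Fin n)} (ε : ↥P ≃ ↥Q)
    (hJQ : J.card = Q.card) (hne : J ≠ Q) :
    ∑ b : ↥P ≃ ↥J, ∏ p : ↥P, (if ((ε p : ↥Q) : Fin n) = ((b p : ↥J) : Fin n) then (1 : ℂ) else 0) = 0 := by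
  refine Finset.sum_eq_zero fun b _ => ?_
  rw [Finset.prod_boole]
  rw [if_neg]
  intro hall
  apply hne
  -- every element of `J` is the image under `ε` of something, hence lies in `Q`
  have hsub : J ⊆ Q := by
    intro j hj
    have hq := hall (b.symm ⟨j, hj⟩) (Finset.mem_univ _)
    rw [Equiv.apply_symm_apply] at hq
    have : ((ε (b.symm ⟨j, hj⟩) : ↥Q) : Fin n) ∈ Q := (ε (b.symm ⟨j, hj⟩)).2
    rw [hq] at this
    exact this
  exact Finset.eq_of_subset_of_card_le hsub hJQ.ge

/-- With equal targets the same bijection-sum is `1`: exactly `b = ε` contributes. [folklore] -/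
theorem sum_equiv_prod_indicator_eq_one {n : ℕ} {P Q : Finset (Fin n)} (ε : ↥P ≃ ↥Q) :
    ∑ b : ↥P ≃ ↥Q, ∏ p : ↥P, (if ((ε p : ↥Q) : Fin n) = ((b p : ↥Q) : Fin n) then (1 : ℂ) else 0) = 1 := by
  rw [Finset.sum_eq_single ε]
  · rw [Finset.prod_eq_one]
    intro p _
    rw [if_pos rfl]
  · intro b _ hb
    rw [Finset.prod_boole, if_neg]
    intro hall
    apply hb
    ext p
    exact congrArg Fin.val (hall p (Finset.mem_univ _)).symm
  · intro h
    exact absurd (Finset.mem_univ ε) h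

/-! ## S1: line-flat of order `k` ⇒ permanental rank `≤ k` -/

/-- **S1 `stub_permRank_of_lineFlat` of the lines «slow_planes» / «flag_cost» (`PermRankOfLineFlat` with `LineFlat`,
`lineSubst`, `PermRankLE` unfolded verbatim):** if along every line `x + s·v` with `v ∈ K` the permanent has `s`-degree `≤ k`,
then every `(k+1) × (k+1)` subpermanent of every `v ∈ K` vanishes. [folklore] -/
theorem permRank_of_lineFlat (n k : ℕ) (K : Submodule ℂ (Fin n × Fin n → ℂ))
    (hK : ∀ x v : Fin n × Fin n → ℂ, v ∈ K →
      (aeval (fun c => (C (x c) + ∑ t : Fin 1, C (v c) * X t : MvPolynomial (Fin 1) ℂ))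
        (perPoly (Fin n) ℂ)).totalDegree ≤ k)
    (v : Fin n × Fin n → ℂ) (hv : v ∈ K) (r c : Fin (k + 1) ↪ Fin n) :
    (Matrix.of fun i j => v (r i, c j)).permanent = 0 := by
  classical
  -- the row set `P` and the column set `Q`
  set P : Finset (Fin n) := Finset.univ.map r with hPdef
  set Q : Finset (Fin n) := Finset.univ.map c with hQdef
  have hPcard : P.card = k + 1 := by rw [hPdef, Finset.card_map, Finset.card_univ, Fintype.card_fin]
  have hQcard : Q.card = k + 1 := by rw [hQdef, Finset.card_map, Finset.card_univ, Fintype.card_fin]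
  have hmemP : ∀ a, r a ∈ P := fun a => by rw [hPdef]; exact Finset.mem_map_of_mem _ (Finset.mem_univ a)
  have hmemQ : ∀ a, c a ∈ Q := fun a => by rw [hQdef]; exact Finset.mem_map_of_mem _ (Finset.mem_univ a)
  -- a bijection between the complements (same size)
  have hcard : Fintype.card ↥(Pᶜ) = Fintype.card ↥(Qᶜ) := by
    rw [Fintype.card_coe, Fintype.card_coe, Finset.card_compl, Finset.card_compl, hPcard, hQcard]
  let ε : ↥(Pᶜ) ≃ ↥(Qᶜ) := Fintype.equivOfCardEq hcard
  -- the base point: the partial permutation matrix of `ε` on the rows outside `P`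
  let x : Fin n × Fin n → ℂ := fun ij =>
    if h : ij.1 ∈ Pᶜ then (if ((ε ⟨ij.1, h⟩ : ↥(Qᶜ)) : Fin n) = ij.2 then 1 else 0) else 0
  have hxP : ∀ i, i ∈ P → ∀ j, x (i, j) = 0 := by
    intro i hi j
    have : ¬ i ∈ Pᶜ := by rw [Finset.mem_compl]; exact fun h => h hi
    simp only [x, dif_neg this]
  have hxPc : ∀ (p : ↥(Pᶜ)) (j : Fin n), x ((p : Fin n), j) = if ((ε p : ↥(Qᶜ)) : Fin n) = j then 1 else 0 := by
    intro p j
    simp only [x, dif_pos p.2]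
  -- the substituted matrix and its permanent
  set A : Matrix (Fin n) (Fin n) (MvPolynomial (Fin 1) ℂ) :=
    Matrix.of fun i j => (C (x (i, j)) + ∑ t : Fin 1, C (v (i, j)) * X t : MvPolynomial (Fin 1) ℂ) with hAdef
  have hper : aeval (fun cc => (C (x cc) + ∑ t : Fin 1, C (v cc) * X t : MvPolynomial (Fin 1) ℂ))
      (perPoly (Fin n) ℂ) = A.permanent := by
    rw [aeval_perPoly]
  have hdeg := hK x v hv
  rw [hper] at hdeg
  -- the coefficient of `s^{k+1}` vanishes
  have hcoeff : coeff (Finsupp.single 0 (k + 1)) A.permanent = 0 := by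
    apply coeff_eq_zero_of_totalDegree_lt
    rw [Finsupp.support_single _ (Nat.succ_ne_zero k), Finset.sum_singleton, Finsupp.single_eq_same]
    omega
  -- entries of `A`
  have hAP : ∀ (p : ↥P) (j : Fin n), A (p : Fin n) j = C (v ((p : Fin n), j)) * X 0 := by
    intro p j
    simp only [hAdef, Matrix.of_apply, hxP p p.2, Fin.sum_univ_one, map_zero, zero_add]
  have hAc : ∀ (p : ↥(Pᶜ)) (j : Fin n),
      A (p : Fin n) j = C (x ((p : Fin n), j)) + C (v ((p : Fin n), j)) * X 0 := by
    intro p j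
    simp only [hAdef, Matrix.of_apply, Fin.sum_univ_one]
  -- Laplace expansion along the rows `P`
  have hL := permanent_eq_sum_powersetCard_mul A P
  -- first factor: `s^{k+1} · per v[P,J]`
  have hfirst : ∀ J : Finset (Fin n), (∑ b : ↥P ≃ ↥J, ∏ p : ↥P, A p (b p))
      = monomial (Finsupp.single 0 (k + 1)) (∑ b : ↥P ≃ ↥J, ∏ p : ↥P, v ((p : Fin n), ((b p : ↥J) : Fin n))) := by
    intro J
    rw [map_sum]
    refine Finset.sum_congr rfl fun b _ => ?_
    simp_rw [hAP]
    rw [Finset.prod_mul_distrib, Finset.prod_const, Finset.card_univ, Fintype.card_coe, hPcard, ← map_prod,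
      C_mul_X_pow_eq_monomial]
  -- second factor: constant term `[J = Q]`
  have hconst : ∀ J : Finset (Fin n), constantCoeff (∑ b' : ↥(Pᶜ) ≃ ↥(Jᶜ), ∏ p : ↥(Pᶜ), A p (b' p))
      = ∑ b' : ↥(Pᶜ) ≃ ↥(Jᶜ), ∏ p : ↥(Pᶜ),
          (if ((ε p : ↥(Qᶜ)) : Fin n) = ((b' p : ↥(Jᶜ)) : Fin n) then (1 : ℂ) else 0) := by
    intro J
    rw [map_sum]
    refine Finset.sum_congr rfl fun b' _ => ?_
    rw [map_prod]
    refine Finset.prod_congr rfl fun p _ => ?_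
    rw [hAc, map_add, map_mul, constantCoeff_C, constantCoeff_C, constantCoeff_X, mul_zero, add_zero, hxPc]
  -- put together: the coefficient of `s^{k+1}` of the Laplace expansion
  have hQmem : Q ∈ (Finset.univ : Finset (Fin n)).powersetCard P.card := by
    rw [Finset.mem_powersetCard, hPcard, hQcard]; exact ⟨Finset.subset_univ _, rfl⟩
  have hkey : coeff (Finsupp.single 0 (k + 1)) A.permanent
      = ∑ b : ↥P ≃ ↥Q, ∏ p : ↥P, v ((p : Fin n), ((b p : ↥Q) : Fin n)) := by
    rw [hL, coeff_sum, Finset.sum_eq_single_of_mem Q hQmem]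
    · rw [hfirst, coeff_monomial_mul', if_pos le_rfl, tsub_self, ← constantCoeff_eq, hconst,
        sum_equiv_prod_indicator_eq_one ε, mul_one]
    · intro J hJ hJQ
      rw [Finset.mem_powersetCard] at hJ
      rw [hfirst, coeff_monomial_mul', if_pos le_rfl, tsub_self, ← constantCoeff_eq, hconst]
      have hJQc : Jᶜ ≠ Qᶜ := fun h => hJQ (compl_injective h)
      have hcardJQ : (Jᶜ).card = (Qᶜ).card := by rw [Finset.card_compl, Finset.card_compl, hJ.2, hPcard, hQcard]
      rw [sum_equiv_prod_indicator_eq_zero ε hcardJQ hJQc, mul_zero]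
  -- identify the bijection-sum minor with the honest permanent of the `Fin (k+1)`-indexed submatrix
  let eP : Fin (k + 1) ≃ ↥P := Equiv.ofBijective (fun a => ⟨r a, hmemP a⟩)
    ⟨fun a b h => r.injective (congrArg Subtype.val h), fun p => by
      obtain ⟨a, _, ha⟩ := Finset.mem_map.1 (by rw [← hPdef]; exact p.2)
      exact ⟨a, Subtype.ext ha⟩⟩
  let eQ : Fin (k + 1) ≃ ↥Q := Equiv.ofBijective (fun a => ⟨c a, hmemQ a⟩)
    ⟨fun a b h => c.injective (congrArg Subtype.val h), fun q => by
      obtain ⟨a, _, ha⟩ := Finset.mem_map.1 (by rw [← hQdef]; exact q.2)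
      exact ⟨a, Subtype.ext ha⟩⟩
  have hV := sum_equiv_prod_eq_permanent_submatrix (Matrix.of fun i j : Fin n => v (i, j)) P Q eP eQ
  have hsub : (Matrix.of fun i j : Fin n => v (i, j)).submatrix (fun a => (eP a : Fin n)) (fun b => (eQ b : Fin n))
      = Matrix.of fun i j => v (r i, c j) := by
    ext a b
    rfl
  rw [← hsub, ← hV]
  have h2 : (∑ b : ↥P ≃ ↥Q, ∏ p : ↥P, (Matrix.of fun i j : Fin n => v (i, j)) p (b p))
      = ∑ b : ↥P ≃ ↥Q, ∏ p : ↥P, v ((p : Fin n), ((b p : ↥Q) : Fin n)) := by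
    rfl
  rw [h2, ← hkey, hcoeff]

end Summit.ValiantsHypothesis.ValiantsHypothesis.Theorems.GrenetZeon.SlowPlanes

end
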